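import Literature.AlgebraicGeometry.Resolution.ResolutionOfSingularities
import Literature.AlgebraicGeometry.Resolution.LocalUniformization
import Literature.AlgebraicGeometry.Resolution.RankOneReduction
import Mathlib.RingTheory.KrullDimension.Basic
import Mathlib.RingTheory.AdicCompletion.Basic
import Mathlib.Algebra.Polynomial.Eval.Defs
import HarnessLib

/-!
# Cossart–Piltant: resolution of arithmetical threefolds — the architecture of the proof

Topic: `Literature/AlgebraicGeometry/Resolution`. This file holds the first layers of the
decomposition (two layers) of the named fact `CossartPiltant2019` (weak resolution of reduced separated schemes
of finite type and dimension `≤ 3` over an arbitrary field; `ResolutionOfSingularities.lean`) along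
the printed proof of

* V. Cossart, O. Piltant, *Resolution of singularities of arithmetical threefolds*, J. Algebra
  529 (2019) 268–535 (= arXiv:1412.0868, *Resolution of Singularities of Arithmetical Threefolds
  II*). NUMBERING: the statements were read (and are quoted verbatim) from arXiv:1412.0868
  **v1** (2014, the version held in the literature store); the journal article = arXiv v2 (2019)
  renumbers Ch. 1 and Ch. 4 (mapping checked in the journal PDF by two gate reviewers, p4262 and
  p4277): v1 Thm. 1.4 = journal Thm. 1.5; v1 Prop. 4.2 (CJS) = 4.3; v1 Prop. 4.3
  (principalization) = 4.4; v1 Prop. 4.4 (patching) = **4.6**; v1 Prop. 4.6 (complete local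
  domains) = **4.8**; v1 Prop. 4.8 (core ⇒ Thm. 1.1) = **4.10**; v1 Prop. 4.9 (Galois
  approximation) = 4.13; Thm. 1.1, Cor. 1.2, §4.1 (LU), Lemma 4.5 unchanged. Locators in
  `[cite: …]` give the JOURNAL number first and the v1 number in parentheses; the prose of this
  header uses v1 numbers.

## The printed architecture (CP 2019, §1.1 and Ch. 4; arXiv v1 numbers)

* **Thm. 1.1** (main theorem): `𝒳` reduced, separated, Noetherian, quasi-excellent, `dim ≤ 3` ⇒
  there is a proper birational `π : 𝒳' → 𝒳` with (i) `𝒳'` regular, (ii)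
  `π⁻¹(Reg 𝒳) ≅ Reg 𝒳`, (iii) `π⁻¹(Sing 𝒳)` a strict normal crossings divisor.
* **(LU)** (§4.1): for a quasi-excellent local domain `(A, m, k)` with quotient field `K`: for
  every valuation `v` of `K` with `A ⊆ 𝒪_v`, `m_v ∩ A = m`, `k_v | k` algebraic, there is a finitely
  generated `A`-algebra `T`, `A ⊆ T ⊆ 𝒪_v`, with `T_P` regular, `P := m_v ∩ T`.
* **Prop. 4.4** (enhanced Zariski patching): if (LU) holds for every local ring `𝒪_{𝒳ᵢ,xᵢ}` of
  dimension three of the irreducible components `𝒳ᵢ` of `𝒳`, then Thm. 1.1 holds for `𝒳` (the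
  proof uses resolution of excellent surfaces, Lipman 1978 / Cossart–Jannsen–Saito, for the
  components of dimension `≤ 2`, elimination of indeterminacies Lemma 4.5, principalization
  Prop. 4.3, embedded resolution of surfaces Prop. 4.2, and quasi-compactness of the
  Riemann–Zariski space).
* **Prop. 4.6**: (LU) for complete local domains of dimension three ⇒ Thm. 1.1.
* **Prop. 4.8**: Thm. 1.4 ⇒ Thm. 1.1, where **Thm. 1.4** is local uniformization by
  Hironaka-permissible local blow-ups for `h = X^p + f₁X^{p-1} + ⋯ + f_p` over an excellent regular
  local ring of dimension three (purely inseparable or `ℤ/p`-Galois case) — the technical core,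
  Chapters 5–9.

## Content of this file (specialised to schemes of finite type over a field, which are excellent)

* `ResolutionOverUpToDim k d` — the weak resolution statement for reduced separated `k`-schemes
  of finite type of (topological Krull) dimension `≤ d`; `CossartPiltant2019` is literally
  `∀ k, ResolutionOverUpToDim k 3` (`cossartPiltant2019_iff`).
* `LocalUniformization3 k` — (LU) over the field `k` in dimension `≤ 3`, in the language of
  Mathlib's `ValuationSubring` / `Subalgebra` (RELATIVE Zariski local uniformization of affine
  models of dimension `≤ 3`): for a valuation ring `O` of `K ⊇ k` and a finitely generated
  `k`-subalgebra `A ⊆ O` with `Frac A = K` and `dim A ≤ 3`, there is a finitely generated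
  `A ⊆ A' ⊆ O` whose localisation at the centre `𝔪_O ∩ A'` is a regular local ring.
* `CossartJannsenSaito2020` — NAMED FACT: resolution of reduced excellent schemes of dimension
  `≤ 2` (Cossart–Jannsen–Saito 2020, Thm. 1.2), weak form over a field:
  `∀ k, ResolutionOverUpToDim k 2`.
* `CossartPiltant2019LU3` — NAMED FACT: `∀ k, LocalUniformization3 k` (CP 2019: the (LU) form of
  Thm. 1.1, see below).
* `CossartPiltant2019Patching` — NAMED FACT (CP 2019, Prop. 4.4, specialised):
  `∀ k, ResolutionOverUpToDim k 2 → LocalUniformization3 k → ResolutionOverUpToDim k 3`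
  (PROVED modulo `CossartPiltant2019Principalization` downstream:
  `CossartPiltant2019Patching.of_principalization`, `BadCurveInduction.lean`; see its STATUS).
* `cossartPiltant2019_of_patching` — PROVED assembly:
  `CossartJannsenSaito2020 → CossartPiltant2019LU3 → CossartPiltant2019Patching →
  CossartPiltant2019`.
* API: `LocalUniformization3.isLocallyUniformizable` (relative ⇒ the absolute weak
  `IsLocallyUniformizable` of `LocalUniformization.lean`), `isFractionRing_of_le`,
  `LocalUniformization3.of_relLocalUniformization` (`RelLocalUniformization` of
  `RankOneReduction.lean`, which has no dimension bound, implies it, in universe `0`).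

Second layer (CP 2019, §4.2, pure commutative algebra):

* `CPLocalUniformization A` — the printed (LU) for a local domain `(A, 𝔪, k)`: for every valuation
  ring `O` of `K = Frac A` containing `A` and dominating it (`𝔪 ⊆ 𝔪_O`) whose residue field is
  algebraic over `k`, there is a finitely generated `A`-algebra `T = A[s] ⊆ O` whose localisation
  at `𝔪_O ∩ T` is regular.
* `CossartPiltant2019LUComplete3` — NAMED FACT: (LU) for every complete Noetherian local domain
  of dimension three (CP 2019, proof of Prop. 4.8: "it is sufficient to prove that (LU) holds for
  every complete local domain `(A,m,k)` of dimension three", which §4.2 then does from Thm. 1.4;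
  also a corollary of Cor. 1.2).
* `CossartPiltant2019LU3OfComplete` — NAMED FACT (CP 2019, Prop. 4.6 "Assume that (LU) holds
  for every complete local domain of dimension three. Then theorem 1.1 holds", with Thm. 1.1
  specialised to its corollary `CossartPiltant2019LU3`).
* `CossartPiltant2019LU3.of_complete`, `cossartPiltant2019_of_complete` — PROVED assemblies;
  `cpLocalUniformization_iff` — (LU) with `T` as a finitely generated subalgebra (`Subalgebra.FG`);
  `cpLocalUniformization_of_field` — sanity: fields have (LU).

## Faithfulness notes

* `LocalUniformization3 k` versus the printed (LU). For `X` of finite type over `k` and a point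
  `x` of an irreducible component `Xᵢ` (function field `K = k(Xᵢ)`, `trdeg = dim Xᵢ ≤ 3`), pick an
  affine chart `Spec A ∋ x`: `A` is a finitely generated `k`-domain with `Frac A = K`,
  `dim A ≤ 3`, and `𝒪_{Xᵢ,x} = A_𝔭`. A valuation ring `𝒪_v` dominating `A_𝔭` contains `A`; given
  `A ⊆ A' ⊆ 𝒪_v` finitely generated over `k` with `A'_{𝔪_v ∩ A'}` regular, the finitely generated
  `A_𝔭`-algebra `T := A_𝔭[A'] ⊆ 𝒪_v` has `T_{𝔪_v ∩ T} = A'_{𝔪_v ∩ A'}` (elements of `A ∖ 𝔭` are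
  units at the centre). Hence `LocalUniformization3 k` implies (LU) for every local ring
  `𝒪_{Xᵢ,x}` (for all dominating valuations, not only those with algebraic residue extension), so
  `CossartPiltant2019Patching` is WEAKER than Prop. 4.4 (it also takes surface resolution, used
  inside the printed proof via [L3], as an explicit hypothesis).
* `CossartPiltant2019LU3` is a COROLLARY of Thm. 1.1 (and is what Props. 4.6/4.8 + Thm. 1.4
  establish on the way): for `A` as above, `𝒳 = Spec A` is reduced, separated, excellent of
  dimension `≤ 3`; Thm. 1.1 gives `π : 𝒳' → 𝒳` projective with `𝒳'` regular and `π` an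
  isomorphism over `Reg 𝒳 ∋ η`. By the valuative criterion of properness `Spec 𝒪_v → 𝒳` lifts to
  `𝒳'`; the centre `x'` lies on the component of `𝒳'` through the generic point (regular local
  rings are domains), so `𝒪_{𝒳',x'} ⊆ 𝒪_v` inside `K`; an affine neighbourhood `Spec T ∋ x'` in
  that component is a finitely generated `A`-algebra, a domain with `Frac T = K`,
  `A ⊆ T ⊆ 𝒪_{𝒳',x'} = T_{𝔪_v ∩ T} ⊆ 𝒪_v`, regular at the centre. Take `A' := T`.
* Conclusions are the WEAK resolution `Scheme.HasResolution` (proper + `IsBirational` + regular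
  source): from Thm. 1.1 take `U = Reg 𝒳`, open (schemes of finite type over a field are J-2) and
  dense (`𝒳` reduced ⇒ generic points are regular), with `π⁻¹(U)` dense in `𝒳'` by (iii); from
  CJS Thm. 1.2 likewise (`π` is a composition of blow-ups in nowhere dense regular centres inside
  the singular loci and an isomorphism over `X_reg`).
* `CPLocalUniformization A` renders "`k_v | k` algebraic" elementarily: every `x ∈ O` satisfies
  `v(p(x)) > 0` for some `p ∈ A[X]` with a coefficient outside `𝔪` (reduce `p` modulo `𝔪`), and
  "`m_v ∩ A = m`" as `𝔪 ⊆ 𝔪_O` (the reverse inclusion is automatic: `𝔪_O ∩ A` is a proper ideal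
  of the local ring `A`). "A finitely generated `A`-algebra `T`, `A ⊆ T ⊆ 𝒪_v`" is
  `Algebra.adjoin A s` for a finite `s ⊆ K` with `A[s] ⊆ O`. The property quantifies over every
  fraction field `K` of `A` in the universe of `A` (all isomorphic to `QF(A)`).
* `CossartPiltant2019LU3OfComplete`: its hypothesis is (LU) for all complete Noetherian local
  domains of dimension three (as in Prop. 4.6); its conclusion `CossartPiltant2019LU3` is a
  corollary of Thm. 1.1 (previous item), which is Prop. 4.6's conclusion.
* Sizes (for the prover programme): `CossartPiltant2019Patching` and `CossartJannsenSaito2020`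
  are each a theory on top of Mathlib (blow-ups, excellent rings, Hilbert–Samuel strata,
  Riemann–Zariski spaces are absent); `CossartPiltant2019LUComplete3` is the 200-page core
  (Thm. 1.4, Chapters 5–9, plus the reduction to cyclic coverings §4.2–4.3);
  `CossartPiltant2019LU3OfComplete` is the descent argument of Prop. 4.6 (rank-one reduction
  [NSp], CoP1 Prop. 6.2/9.1, EGA IV 7.7.3, 7.9.3.1) — but NOT only that: its printed proof also
  takes Thm. 1.1 for `Spec Â` (i.e. Prop. 4.4 with [L3]) and, in Lemma 4.7, embedded resolution
  of surfaces (Prop. 4.2), and its conclusion `CossartPiltant2019LU3` moreover contains local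
  uniformization of the affine models of dimension `≤ 2` (again [L3]); see the STATUS paragraph of
  its docstring (split review 2026-08-15) and the proved reductions
  `ArithmeticalThreefoldsClosedPoints.lean`, `ArithmeticalThreefoldsHeadReduction.lean`. They are
  vendored as honest named facts; only the assemblies are proved here. Next definitions needed to
  go deeper: (quasi-)excellent rings, blow-ups / local quadratic transforms, Hironaka-permissible
  centres. UPDATE (split review of `CossartPiltant2019Patching`, 2026-08-15): those notions and
  the whole patching argument now exist in the tree — `CossartPiltant2019Patching` is PROVED
  modulo the principalization Prop. 4.4 of the journal version (v1 Prop. 4.3), the named fact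
  `CossartPiltant2019Principalization`; see the STATUS paragraph of its docstring and
  `PatchingTrustBase.lean`.

## Sources

* V. Cossart, O. Piltant, J. Algebra 529 (2019) 268–535 = arXiv:1412.0868v2: Thm. 1.1, Cor. 1.2,
  §4.1 (LU), Props. 4.6, 4.8, 4.10, Thm. 1.5 (arXiv v1: Props. 4.4, 4.6, 4.8, Thm. 1.4).
  [CossartPiltant2019]
* V. Cossart, U. Jannsen, S. Saito, *Desingularization: Invariants and Strategy — Application to
  Dimension 2*, Lecture Notes in Math. 2270, Springer 2020, Thm. 1.2 (canonical controlled
  resolution of reduced excellent Noetherian schemes of dimension `≤ 2`). [CossartJannsenSaito2020]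
* O. Zariski, *Reduction of the singularities of algebraic three dimensional varieties*, Ann. of
  Math. 45 (1944) 472–542 (the patching theorem, p. 539).
* J. Lipman, *Desingularization of two-dimensional schemes*, Ann. of Math. 107 (1978) 151–207.
-/

noncomputable section

open CategoryTheory AlgebraicGeometry TopologicalSpace

namespace Literature.AlgebraicGeometry.Resolution

universe u

/-! ## The statements per field and dimension -/

/-- **Weak resolution over `k` up to dimension `d`**: every reduced separated `k`-scheme of finite
type `X → Spec k` of topological Krull dimension `≤ d` admits a resolution of singularities
(a proper birational `π : X̃ → X` with `X̃` regular, `Scheme.HasResolution`). For `d = 3` and all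
`k` this is `CossartPiltant2019` (`cossartPiltant2019_iff`).
[cite: CossartPiltant2019, Thm. 1.1 (the statement, specialised)] -/
def ResolutionOverUpToDim (k : Type u) [Field k] (d : ℕ) : Prop :=
  ∀ (X : Scheme.{u}) (f : X ⟶ Spec (.of k)),
    IsSeparated f → LocallyOfFiniteType f → QuasiCompact f → IsReduced X →
      topologicalKrullDim X ≤ d → Scheme.HasResolution X

/-- **Local uniformization in dimension `≤ 3` over `k`, relative form** (Cossart–Piltant 2019,
§4.1, statement (LU), for the local rings of threefolds over the field `k`, written on affine
models): for every field `K ⊇ k`, valuation ring `O` of `K` and finitely generated `k`-subalgebra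
`A ⊆ O` with `Frac A = K` and `dim A ≤ 3` (an affine model of `K` of dimension `≤ 3` on which `O`
has a centre), there is a finitely generated `k`-subalgebra `A'` with `A ⊆ A' ⊆ O` whose
localisation at the centre `𝔪_O ∩ A'` is a regular local ring. (CP's (LU) for the local ring
`A_𝔭`, `𝔭 = 𝔪_O ∩ A`, asks for a finitely generated `A_𝔭`-algebra `T ⊆ 𝒪_v` regular at the
centre; `T := A_𝔭[A']` is one, see the module docstring.) Same conclusion shape as the
dimension-free `RelLocalUniformization k K O` of `RankOneReduction.lean` (the form route
`Valuative` consumes; `LocalUniformization3.of_relLocalUniformization`) and it yields the absolute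
`IsLocallyUniformizable k K O` (`LocalUniformization3.isLocallyUniformizable`).
[cite: CossartPiltant2019, §4.1 (LU)] -/
def LocalUniformization3 (k : Type u) [Field k] : Prop :=
  ∀ (K : Type u) [Field K] [Algebra k K] (O : ValuationSubring K) (A : Subalgebra k K),
    A.toSubring ≤ O.toSubring → A.FG → IsFractionRing A K → ringKrullDim A ≤ 3 →
      ∃ (A' : Subalgebra k K) (h : A'.toSubring ≤ O.toSubring), A ≤ A' ∧ A'.FG ∧
        IsRegularLocalRing (Localization.AtPrime (centreIdeal A' O h))

/-- **Cossart–Piltant's local uniformization property (LU) of a local domain** `(A, 𝔪, k)` with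
quotient field `K` (Cossart–Piltant 2019, §4.1: "(LU) for every valuation `v` of `K`, with valuation
ring `(𝒪_v, m_v, k_v)` such that `A ⊂ 𝒪_v ⊂ K`, `m_v ∩ A = m`, `k_v | k` algebraic, there exists a
finitely generated `A`-algebra `T`, `A ⊆ T ⊆ 𝒪_v`, such that `T_P` is regular, where
`P := m_v ∩ T`"). Rendering: `O` a valuation subring of a fraction field `K` of `A` containing `A`,
with `v(a) < 1` for `a ∈ 𝔪` (domination) and every element of `O` a root modulo `𝔪_O` of a
polynomial over `A` not all of whose coefficients lie in `𝔪` (residue field algebraic over `k`);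
`T = A[s]` for a finite `s ⊆ K`. [cite: CossartPiltant2019, §4.1 (LU)] -/
def CPLocalUniformization (A : Type u) [CommRing A] [IsDomain A] [IsLocalRing A] : Prop :=
  ∀ (K : Type u) [Field K] [Algebra A K] [IsFractionRing A K] (O : ValuationSubring K),
    (∀ a : A, algebraMap A K a ∈ O) →
    (∀ a ∈ IsLocalRing.maximalIdeal A, O.valuation (algebraMap A K a) < 1) →
    (∀ x : O, ∃ p : Polynomial A, (∃ i, p.coeff i ∉ IsLocalRing.maximalIdeal A) ∧
        O.valuation (p.eval₂ (algebraMap A K) x) < 1) →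
      ∃ (s : Finset K) (h : (Algebra.adjoin A (s : Set K)).toSubring ≤ O.toSubring),
        IsRegularLocalRing (Localization.AtPrime
          (Ideal.comap (Subring.inclusion h) (IsLocalRing.maximalIdeal O)))

/-! ## Named facts -/

/-- NAMED FACT — **Cossart–Jannsen–Saito: resolution of excellent surfaces** (Cossart–Jannsen–Saito
2020, Thm. 1.2 "Canonical Controlled Resolution": for a reduced, excellent, Noetherian scheme `X`
of dimension `≤ 2` there is a canonical finite sequence of blow-ups in permissible centres
contained in the singular loci `π : X' = X_n → ⋯ → X_0 = X` with `X'` regular; `π` is an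
isomorphism over `X_reg`; earlier: Lipman 1978 for excellent surfaces). Vendored in the WEAK form
used here, for reduced separated schemes of finite type over a field (excellent) of dimension
`≤ 2`: a proper birational `π` from a regular scheme exists (blow-ups are proper; `π` is an
isomorphism over the dense open `X_reg`, whose preimage is dense since the centres are nowhere
dense). Users take `(h : CossartJannsenSaito2020)`. [cite: CossartJannsenSaito2020, Thm. 1.2] -/
def CossartJannsenSaito2020 : Prop :=
  ∀ (k : Type u) [Field k], ResolutionOverUpToDim k 2

/-- NAMED FACT — **Cossart–Piltant, local uniformization in dimension three** (Cossart–Piltant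
2019: the local-uniformization form (LU), §4.1, of Thm. 1.1 for local rings of schemes of finite
type over a field of dimension `≤ 3`; a corollary of Thm. 1.1 applied to `Spec A` by the
valuative criterion of properness, and the statement established on the way to Thm. 1.1 by
the local theorem, journal Thm. 1.5 with Props. 4.8, 4.10 = arXiv v1 Thm. 1.4 with Props. 4.6,
4.8): `LocalUniformization3 k` for every field `k`, of any
characteristic. Users take `(h : CossartPiltant2019LU3)`.
[cite: CossartPiltant2019, Thm. 1.1 with §4.1 (LU)] -/
def CossartPiltant2019LU3 : Prop :=
  ∀ (k : Type u) [Field k], LocalUniformization3 k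

/-- NAMED FACT — **Cossart–Piltant's enhanced Zariski patching** (Cossart–Piltant 2019, Prop. 4.6
of the journal version = Prop. 4.4 of arXiv v1:
"Let `𝒳` be a reduced and separated Noetherian scheme which is quasi-excellent and of dimension at
most three. Let `𝒳₁, …, 𝒳_c` be the irreducible components of `𝒳`. Assume that (LU) holds for
every local ring of the form `A = 𝒪_{𝒳ᵢ,xᵢ}` which is of dimension three, `1 ≤ i ≤ c`. Then
theorem 1.1 holds"; the proof invokes resolution of excellent surfaces [L3] for the components of
dimension `≤ 2`). Vendored, for schemes of finite type over a field `k`, with BOTH inputs as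
hypotheses: surface resolution over `k` and (LU) over `k` in dimension `≤ 3` imply weak resolution
of reduced separated `k`-schemes of finite type of dimension `≤ 3`. Users take
`(h : CossartPiltant2019Patching)`.

STATUS (split review, 2026-08-15). Sound and faithful as stated — the source's patching
proposition is arXiv v1 p. 50, Prop. 4.4 (journal Prop. 4.6), quoted above, and this is its
specialisation to schemes of finite type over a field, WEAKENED by the second hypothesis (surface
resolution, the input [L3] of Step 1 of the printed proof); a theorem of the source, not a
conjecture, and implied outright by `CossartPiltant2019` (`CossartPiltant2019.patching`,
`ResolutionLU.lean`). Its printed proof (v1 pp. 50–52, "an enhanced version of Zariski's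
Patching Theorem [Z5] Fundamental theorem on p.539": Step 1 components and [L3], Step 2 gluing
of affine pieces by Lemma 4.5, Step 3 quasi-compactness of `Zar(𝒳)` [ZS2, Thm. 40] and the
patching of two projective models, Step 4 the isomorphism over `Reg 𝒳`) is PROVED in the tree
down to the one of its three characteristic-free inputs (v1 p. 50, Props. 4.1–4.3) that is a
three-dimensional theorem of its own, Cossart–Piltant's principalization on regular excellent
threefolds, journal Prop. 4.4 = v1 Prop. 4.3 ([CoP1] Prop. 4.2 with [CoP3] Thm. II.3), the named
fact `CossartPiltant2019Principalization` (`Principalization.lean`):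
`CossartPiltant2019Patching.of_twoModelPatching` (`ZariskiPatchingGlue.lean`, on
`ZariskiRiemannSpace.lean`, `ZariskiFiniteness.lean`, `ProjectiveModels.lean`: Zariski's
compactness, finite resolving systems, reduction to the patching of two projective models of a
function field of transcendence degree three) and `CossartPiltant2019Patching.of_principalization :
CossartPiltant2019Principalization → CossartPiltant2019Patching` (`BadCurveInduction.lean`, with
`PatchingMorphismStep.lean`, `PatchingStepFive.lean`, `BadCurveStep.lean`: the two-model patching,
Zariski 1944 p. 539 / Piltant 2013 Prop. 5.1 for `P = P_reg`, by the bad-curve induction). That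
fact is in turn PROVED modulo [CoP1] Prop. 4.4 (desingularization of idealistic exponents
`(J, μ)` with `codim V(J) ≥ 2` on the stages of a Cossart–Piltant sequence, by permissible
blowing ups), `cossartPiltant2019Principalization_of_prop44` (`PrincipalizationOfProp44.lean`),
whose hypothesis `h44` is being assembled along the printed algorithm ([CoP1] pp. 9–14:
`PrincipalizationStages.lean`, `PointCentrePermissible.lean`, `NearPoints*.lean`,
`HironakaDirectrix*.lean`, `NearPointTauMonotone.lean`, `CurveCentreSigmaCoincide.lean`,
`FormalAxisOfNearChain.lean`, …). Nothing of this fact is left to prove on its own: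
`CossartPiltant2019Patching_holds` is the one-liner
`CossartPiltant2019Patching.of_principalization CossartPiltant2019Principalization_holds` once the
latter lands, to be placed downstream of `BadCurveInduction.lean` (which imports this file), and
the parent is rewired onto principalization in `PatchingTrustBase.lean`
(`cossartPiltant2019_of_principalization : CossartJannsenSaito2020 → CossartPiltant2019LU3 →
CossartPiltant2019Principalization → CossartPiltant2019`, `cossartPiltant2019_of_prop44`,
`cossartPiltant2019_iff_of_principalization`). The fact is kept as the node the first layer
pivots on: a hypothesis in `cossartPiltant2019_of_patching`, `ArithmeticalThreefoldsLocal`,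
`Hironaka1964LocalLU`, `Temkin2008`, `LUCompleteChar0TrustBase`, a conjunct in `ResolutionLU`,
`GeneralLU`, the conclusion of `ZariskiPatchingGlue`, `BadCurveInduction`.
[cite: CossartPiltant2019, Prop. 4.6 (arXiv v1: Prop. 4.4), patching] -/
def CossartPiltant2019Patching : Prop :=
  ∀ (k : Type u) [Field k],
    ResolutionOverUpToDim k 2 → LocalUniformization3 k → ResolutionOverUpToDim k 3

/-- NAMED FACT — **Cossart–Piltant, (LU) for complete local domains of dimension three**
(Cossart–Piltant 2019, proof of Prop. 4.10 [arXiv v1: Prop. 4.8], first sentence: "it is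
sufficient to prove that (LU) holds for every complete local domain `(A,m,k)` of dimension three",
established in the rest of §4.2 from Thm. 1.5 [v1: Thm. 1.4] via Cohen structure, Galois
approximation Prop. 4.13 [v1: Prop. 4.9] and reduction to cyclic
coverings of degree `p`; independently a corollary of Cor. 1.2 — a reduced complete Noetherian local
ring of dimension three has a projective good resolution — by the valuative criterion of
properness). For every complete Noetherian local domain `A` of Krull dimension `3`,
`CPLocalUniformization A`. Users take `(h : CossartPiltant2019LUComplete3)`.

STATUS (split review, 2026-08-15). Sound and faithful as stated — (LU) is arXiv v1 p. 50, §4.1,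
"there exists a finitely generated `A`-algebra `T`, `A ⊆ T ⊆ 𝒪_v`, such that `T_P` is regular,
where `P := m_v ∩ T`", under "`A ⊂ 𝒪_v ⊂ K`, `m_v ∩ A = m`, `k_v | k` algebraic", and the
reduction target is v1 p. 53, proof of Prop. 4.8 [journal 4.10], "it is sufficient to prove that
(LU) holds for every complete local domain `(A,m,k)` of dimension three" — and a theorem of the
source (all residue characteristics, the mixed case included), not a conjecture. It is, however,
the apex of the paper rather than a leaf: its printed proof is journal Thm. 1.5 (Chapters 5–9)
together with the climb of the proof of Prop. 4.10 in residue characteristic `p > 0` ([CoP1]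
§§6–9, Props. 4.4, 4.13) and resolution in residue characteristic zero ("the equicharacteristic
zero version of theorem 1.1 being known": Hironaka 1964 / Temkin 2008), each a theory on top of
Mathlib. What the tree PROVES is every assembly: `CossartPiltant2019LUComplete3.of_local`
(`ArithmeticalThreefoldsLocal.lean`: `CossartPiltant2019Local → CossartPiltant2019ReductionP →
CossartPiltant2019LUCompleteChar0 →` this fact, by the dichotomy on the residue characteristic),
`CossartPiltant2019LUComplete3.of_local_temkin2008` / `.of_local_hironaka1964` (the
characteristic-zero leaf re-rooted in `Temkin2008` / `Hironaka1964_local`, the excellence inputs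
Stacks 07QU, 07QW being proved) and, from Thm. 1.1 as printed, `.of_general`
(`LUComplete3TrustBase.lean`); on the proof side of `CossartPiltant2019ReductionP` the steps of
Prop. 4.10's proof preceding the ramification-theoretic climb are proved
(`cossartPiltant2019ReductionP_of_climb`, `ArithmeticalThreefoldsReduction.lean`). A proof of this
fact can only arrive through those leaves — `CossartPiltant2019LUComplete3_holds` is then one of
the one-liners listed in `LUComplete3TrustBase.lean`; it is kept as the node the second layer
pivots on (hypothesis of `CossartPiltant2019LU3OfComplete`, conclusion of `.of_local`,
`.of_general`).
[cite: CossartPiltant2019, Cor. 1.2 and proof of Prop. 4.10 (arXiv v1: Prop. 4.8)] -/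
def CossartPiltant2019LUComplete3 : Prop :=
  ∀ (A : Type u) [CommRing A] [IsDomain A] [IsLocalRing A] [IsNoetherianRing A]
    [IsAdicComplete (IsLocalRing.maximalIdeal A) A], ringKrullDim A = 3 → CPLocalUniformization A

/-- NAMED FACT — **Cossart–Piltant, descent of (LU) from complete local domains** (Cossart–Piltant
2019, Prop. 4.8 of the journal version = Prop. 4.6 of arXiv v1: "Assume that (LU) holds for every
complete local domain of dimension three. Then theorem 1.1 holds"; the proof, arXiv v1
pp. 52–53 in v1 numbering, first reduces by the patching Prop. 4.4 [journal 4.6] to (LU) for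
quasi-excellent local domains `A` of dimension three, then descends (LU) from `Â` to `A` using
the rank-one reduction of Novacoski–Spivakovsky, Thm. 1.1 for `Spec Â` ("By assumption in this
proposition and proposition 4.4, theorem 1.1 holds for `X̂`"), Lemma 4.7 (= CoP1 Prop. 6.2 with
embedded resolution of surfaces, Prop. 4.2 [journal 4.3]), CoP1 Prop. 9.1 and EGA IV 7.7.3,
7.9.3.1). Vendored with Thm. 1.1 replaced by its corollary `CossartPiltant2019LU3` (relative
local uniformization of affine models of dimension `≤ 3` over fields; the corollary is proved in
the tree, `CossartPiltant2019.lu3`, `ResolutionLU.lean`). Users take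
`(h : CossartPiltant2019LU3OfComplete)`.

STATUS (split review, 2026-08-15). Sound as stated, but not provable apart from two inputs that
lie outside it: (i) surface resolution over fields, `CossartJannsenSaito2020` (the input [L3]
of the patching proposition), needed for the affine models of dimension `≤ 2` and the non-closed
centres that `LocalUniformization3` also covers; (ii) the geometric head of the printed descent
(the output of v1 Lemma 4.7: a regular local ring essentially of finite type over `Â` inside
`𝒪_v̂` with a regular system of parameters monomial, up to units, in elements of `K`), which
rests on embedded resolution of surfaces and has no statement in the tree. Everything else of
the printed proof is PROVED: `CossartPiltant2019LU3OfComplete.of_closedPoints`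
(`ArithmeticalThreefoldsClosedPoints.lean`: (i) + (LU) at the maximal ideals of three-dimensional
affine domains suffice) and `CossartPiltant2019LU3OfComplete.of_head`
(`ArithmeticalThreefoldsHeadReduction.lean`, with `…DescentTail`, `…Algebraization`,
`…Monomials`: (i) + the head suffice). The fact is kept as a leaf: it is a hypothesis or a
conclusion in `ResolutionLU`, `GeneralLU`, `ArithmeticalThreefoldsLocal`, `Hironaka1964LocalLU`,
`Temkin2008`, `LUCompleteChar0TrustBase`.
[cite: CossartPiltant2019, Prop. 4.8 (arXiv v1: Prop. 4.6, pp. 52–53), complete local domains] -/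
def CossartPiltant2019LU3OfComplete : Prop :=
  CossartPiltant2019LUComplete3.{u} → CossartPiltant2019LU3.{u}

/-! ## Assembly and API -/

/-- `CossartPiltant2019` is, verbatim, weak resolution over every field up to dimension `3`.
[folklore] -/
theorem cossartPiltant2019_iff :
    CossartPiltant2019.{u} ↔ ∀ (k : Type u) [Field k], ResolutionOverUpToDim k 3 := by
  simp only [CossartPiltant2019, ResolutionOverUpToDim, Nat.cast_ofNat]

/-- `CossartJannsenSaito2020` is weak resolution over every field up to dimension `2`.
[folklore] -/
theorem cossartJannsenSaito2020_iff :
    CossartJannsenSaito2020.{u} ↔ ∀ (k : Type u) [Field k], ResolutionOverUpToDim k 2 :=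
  Iff.rfl

/-- (LU) with the uniformizing algebra packaged as a finitely generated `A`-subalgebra
`T ⊆ O` of `K` (`Subalgebra.FG`) instead of `A[s]` for a finite `s` — the packaging used by
`LocalUniformization3`. [folklore] -/
theorem cpLocalUniformization_iff (A : Type u) [CommRing A] [IsDomain A] [IsLocalRing A] :
    CPLocalUniformization A ↔
      ∀ (K : Type u) [Field K] [Algebra A K] [IsFractionRing A K] (O : ValuationSubring K),
        (∀ a : A, algebraMap A K a ∈ O) →
        (∀ a ∈ IsLocalRing.maximalIdeal A, O.valuation (algebraMap A K a) < 1) →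
        (∀ x : O, ∃ p : Polynomial A, (∃ i, p.coeff i ∉ IsLocalRing.maximalIdeal A) ∧
            O.valuation (p.eval₂ (algebraMap A K) x) < 1) →
          ∃ (T : Subalgebra A K) (h : T.toSubring ≤ O.toSubring), T.FG ∧
            IsRegularLocalRing (Localization.AtPrime
              (Ideal.comap (Subring.inclusion h) (IsLocalRing.maximalIdeal O))) := by
  constructor
  · intro h K _ _ _ O h₁ h₂ h₃
    obtain ⟨s, hs, hreg⟩ := h K O h₁ h₂ h₃
    exact ⟨_, hs, ⟨s, rfl⟩, hreg⟩
  · intro h K _ _ _ O h₁ h₂ h₃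
    obtain ⟨T, hT, ⟨s, rfl⟩, hreg⟩ := h K O h₁ h₂ h₃
    exact ⟨s, hT, hreg⟩

/-- A field is a regular local ring (dimension `0`). [folklore] -/
theorem isRegularLocalRing_of_isField {L : Type*} [CommRing L] (hL : IsField L) :
    IsRegularLocalRing L := by
  letI := hL.toField
  infer_instance

/-- Sanity / dimension zero: a field `k` has property (LU) — every valuation ring of `Frac k = k`
containing `k` is uniformized by `T = k[∅] = k`, whose localisations are fields. (Shows the
hypotheses of `CPLocalUniformization` are jointly satisfiable and its conclusion has the intended
shape.) [folklore] -/
theorem cpLocalUniformization_of_field (k : Type u) [Field k] : CPLocalUniformization k := by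
  intro K _ _ _ O hAO _ _
  have hTO : (Algebra.adjoin k ((∅ : Finset K) : Set K)).toSubring ≤ O.toSubring := by
    intro x hx
    simp only [Finset.coe_empty, Algebra.adjoin_empty] at hx
    obtain ⟨c, rfl⟩ := Algebra.mem_bot.mp hx
    exact hAO c
  refine ⟨∅, hTO, ?_⟩
  set T := (Algebra.adjoin k ((∅ : Finset K) : Set K)).toSubring
  have hT : IsField T := by
    refine ⟨⟨0, 1, zero_ne_one⟩, mul_comm, fun {a} ha => ?_⟩
    have haK : (a : K) ≠ 0 := fun h => ha (Subtype.ext h)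
    have hmem : (a : K)⁻¹ ∈ T := by
      have ha' : (a : K) ∈ Algebra.adjoin k ((∅ : Finset K) : Set K) := a.2
      simp only [Finset.coe_empty, Algebra.adjoin_empty] at ha'
      obtain ⟨c, hc⟩ := Algebra.mem_bot.mp ha'
      have : (algebraMap k K c⁻¹) ∈ Algebra.adjoin k ((∅ : Finset K) : Set K) := by
        simp only [Finset.coe_empty, Algebra.adjoin_empty]
        exact Algebra.mem_bot.mpr ⟨c⁻¹, rfl⟩
      rw [map_inv₀, hc] at this
      exact this
    exact ⟨⟨_, hmem⟩, Subtype.ext (mul_inv_cancel₀ haK)⟩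
  apply isRegularLocalRing_of_isField
  set P := Ideal.comap (Subring.inclusion hTO) (IsLocalRing.maximalIdeal O)
  have h0 : (0 : T) ∉ P.primeCompl := fun h => h P.zero_mem
  exact MulEquiv.isField hT
    (RingEquiv.ofBijective (algebraMap T (Localization.AtPrime P))
      (IsField.localization_map_bijective h0 hT)).symm.toMulEquiv

/-- Weak resolution up to dimension `d` is monotone in `d`. [folklore] -/
theorem ResolutionOverUpToDim.mono {k : Type u} [Field k] {d d' : ℕ} (hd : d ≤ d')
    (h : ResolutionOverUpToDim k d') : ResolutionOverUpToDim k d :=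
  fun X f hs hl hq hr hdim => h X f hs hl hq hr (hdim.trans (by exact_mod_cast hd))

/-- **Assembly of the first layer** (Cossart–Piltant 2019, Ch. 4, patching): surface resolution, local
uniformization in dimension three and the patching proposition give `CossartPiltant2019`.
[cite: CossartPiltant2019, Prop. 4.6 (arXiv v1: Prop. 4.4), patching] -/
theorem cossartPiltant2019_of_patching (hCJS : CossartJannsenSaito2020.{u})
    (hLU : CossartPiltant2019LU3.{u}) (hP : CossartPiltant2019Patching.{u}) :
    CossartPiltant2019.{u} :=
  cossartPiltant2019_iff.mpr fun k _ => hP k (hCJS k) (hLU k)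

/-- Conversely, `CossartPiltant2019` contains surface resolution over fields. [folklore] -/
theorem CossartPiltant2019.cossartJannsenSaito2020 (h : CossartPiltant2019.{u}) :
    CossartJannsenSaito2020.{u} :=
  fun k _ => (cossartPiltant2019_iff.mp h k).mono (by norm_num)

/-- **Assembly of the second layer** (Cossart–Piltant 2019, §4.2, descent): (LU) for complete local domains
of dimension three and the descent proposition give local uniformization in dimension three over
every field.
[cite: CossartPiltant2019, Prop. 4.8 (arXiv v1: Prop. 4.6), complete local domains] -/
theorem CossartPiltant2019LU3.of_complete (hc : CossartPiltant2019LUComplete3.{u})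
    (h46 : CossartPiltant2019LU3OfComplete.{u}) : CossartPiltant2019LU3.{u} :=
  h46 hc

/-- **Assembly of both layers**: surface resolution, (LU) for complete local domains of dimension
three, descent and patching give `CossartPiltant2019`.
[cite: CossartPiltant2019, Ch. 4] -/
theorem cossartPiltant2019_of_complete (hCJS : CossartJannsenSaito2020.{u})
    (hc : CossartPiltant2019LUComplete3.{u}) (h46 : CossartPiltant2019LU3OfComplete.{u})
    (hP : CossartPiltant2019Patching.{u}) : CossartPiltant2019.{u} :=
  cossartPiltant2019_of_patching hCJS (CossartPiltant2019LU3.of_complete hc h46) hP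

/-- A subalgebra containing an affine model of `K` is again a model: if `A ≤ A'` inside the field
`K` and `Frac A = K` then `Frac A' = K`. [folklore] -/
theorem isFractionRing_of_le {k K : Type u} [Field k] [Field K] [Algebra k K]
    {A A' : Subalgebra k K} (hle : A ≤ A') (hA : IsFractionRing A K) : IsFractionRing A' K := by
  refine IsFractionRing.of_field A' K fun z => ?_
  obtain ⟨a, b, -, rfl⟩ := IsFractionRing.div_surjective (A := A) z
  exact ⟨⟨a, hle a.2⟩, ⟨b, hle b.2⟩, rfl⟩

/-- Relative local uniformization in dimension `≤ 3` gives the absolute weak form of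
`LocalUniformization.lean` for every valuation ring having a centre on some affine model of
dimension `≤ 3`. [folklore] -/
theorem LocalUniformization3.isLocallyUniformizable {k : Type u} [Field k]
    (h : LocalUniformization3 k) (K : Type u) [Field K] [Algebra k K] (O : ValuationSubring K)
    (A : Subalgebra k K) (hAO : A.toSubring ≤ O.toSubring) (hfg : A.FG) (hfr : IsFractionRing A K)
    (hdim : ringKrullDim A ≤ 3) : IsLocallyUniformizable k K O := by
  obtain ⟨A', hA'O, hle, hfg', hreg⟩ := h K O A hAO hfg hfr hdim
  exact ⟨A', hA'O, hfg', isFractionRing_of_le hle hfr, hreg⟩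

/-- Under `CossartPiltant2019LU3`, every valuation ring with a centre on an affine model of
dimension `≤ 3` over any field is locally uniformizable.
[cite: CossartPiltant2019, §4.1 (LU)] -/
theorem CossartPiltant2019LU3.isLocallyUniformizable (h : CossartPiltant2019LU3.{u})
    (k K : Type u) [Field k] [Field K] [Algebra k K] (O : ValuationSubring K)
    (A : Subalgebra k K) (hAO : A.toSubring ≤ O.toSubring) (hfg : A.FG) (hfr : IsFractionRing A K)
    (hdim : ringKrullDim A ≤ 3) : IsLocallyUniformizable k K O :=
  (h k).isLocallyUniformizable K O A hAO hfg hfr hdim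

/-- Relative local uniformization of every valuation ring over `k` (the dimension-free
`RelLocalUniformization` of `RankOneReduction.lean`, universe `0`) implies
`LocalUniformization3 k`. [folklore] -/
theorem LocalUniformization3.of_relLocalUniformization {k : Type} [Field k]
    (h : ∀ (K : Type) [Field K] [Algebra k K] (O : ValuationSubring K),
      RelLocalUniformization k K O) :
    LocalUniformization3.{0} k :=
  fun K _ _ O A hAO hfg hfr _ => h K O A hfg hfr hAO

end Literature.AlgebraicGeometry.Resolution

end
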